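import Summits.QuantumFields.BalabanUV.Beta.EriceRemainderEnclosureHistoryAutonomyComparisonAgeComposition

/-!
# EriceRemainderEnclosureHistoryAutonomyComparisonAgeCompositionReadDecay — (E81a) THE READ-DECAY CRITERION: MONO″ (the young drops of the young
# solution of the old surplus are non-increasing in the pin) holds for a window kernel of ANY length as soon as THE YOUNG READS OF THE INPUT DECAY, per
# pin, by at least «(shift-domination defect of the kernel row) × (an upper bound of the drops)» — a STATIC inequality on explicit reads; plus the
# Neumann sandwich that supplies the upper bounds, and the identification «drops solve the same system with the read of the input as input»

Cell `pub-balaban`, β-function sub-cell, BINDER row D4 «RemainderConst leaves for Bałaban's split» (`HOME/BINDER-OWNERS.md`; owner lineage `b2b-balaban-beta-an4`;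
this file by co-owner #2 lineage `b2b-balaban-beta-d4-p2`, generation 72), β-FLOW TEAM duty (1), FREEZE (0) honoured (def-free; imports (E71a)
`…ComparisonAgeComposition` and uses `read_le_read`, `read_nonneg`, `read_sub`, `read_eq_zero_of_tail`, `sol_nonneg_le_of_supersol` BY NAME; nothing restated).

HONEST FRAMING (page 1, verbatim and binding).  *"Discharging BetaPertH makes Bałaban's UV stability UNCONDITIONAL — a real constructive-QFT result; it is
NOT the continuum limit and NOT the Clay problem."*  THIS FILE DISCHARGES NOTHING OF THE KIND.  Elementary real algebra about ABSTRACT triangular renewal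
systems — hypotheses of a census, not facts; the age profile of Bałaban's (1.22) limit functional is NOT PRINTED ([I] p. 298; GAPS G-t4-U2-1∕-2) and NOT
asserted.  Row D4 class UNCHANGED (critical-path width 0; instance 0∕1; D4 DISCHARGE NO DATE).  HONEST DEPENDENCY: continuum YM on T⁴ ⇐ BetaPertH ∧ nine
spine estimates (0/9 proved); BetaPertH ⇐ (D1) ∧ (D4) ∧ CAP+tail; G-an2-4 gates asym, D1 and NE2/3/4.

THE POINT (census sense (α); route (N); `HOME/b2b-balaban-beta-d4-p2/g71/e80/README.md` §4 (2) and this station's README `g72/e81/README.md`).  After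
(E80f) `flow_nonneg_of_mono2` the first-order remainder of route (N) is MONO″ + MONOa.  (E80g) settled MONO″ for a ONE-LAG kernel from «`1∕Kk` grows by one
per pin»; the numerics of this station (`g72/numerics/m8.py`) show that the literal analogue for a window of length `y` — «`1∕x̃` grows by one per pin»,
`x̃` the damped row mass — is FALSE along flows for `y ≥ 3` (the flow supplies only `≈ 2.4∕y` per pin) although MONO″ holds.  THE RIGHT CRITERION aligns
the two consecutive rows by ABSOLUTE depth: for the zero-tailed solution `u` of `u n = A n − R u n` (`R` the read by a non-negative kernel `K` on the
horizon `N`), if `u ≥ 0`, `u ≤ U`, and **`M n · U (n+1) ≤ A n − A (n+1)`** at every pin, with the SHIFT-DOMINATION DEFECT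
`M n = K n 0 + Σ_{l<N−1} (K n (l+1) − K (n+1) l)⁺`, then `u` is NON-INCREASING (`sol_antitone_of_read_decay`; downward induction: against a tail that is
already non-increasing, `R u n − R u (n+1) ≤ M n · u (n+1)` — `read_step_le`).  For the flow's lone kernel of age `y` (entries `c_n·Π_{t=n+1+l}^{n+y} g_t`,
`c` non-increasing, `g ≤ 1`) every row dominates the shifted next row except at the ENTERING LAG, so `M n = x̃_n − x̃_{n+1} + c_{n+1}g_{n+y+1}`: the reads of
the input must decay per pin by the row-mass decrement plus ONE lag's weight — `≈ x̃∕y`, not `x̃`.  The DROPS `d = R t` of the solution `t` of `t = v − R t`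
solve the same system with input `A = R v` (`drops_rec`), and `0 ≤ d ≤ R v` once `0 ≤ t ≤ v` (KEY, (E71a) `sol_nonneg_le_of_supersol`); the Neumann
sandwich (`sol_le_input`, `input_sub_read_le_sol`, `sol_le_input_sub_read`) supplies `U = R v` or the second-order `U = R v − R (R v − R (R v))`.  Hence
**`young_drops_antitone_of_read_decay`**: MONO″ for one age at every pin ⟸ KEY ∧ the read-decay inequality for the young reads `A = R v` of the old
surplus — in the letters of (E80f)'s hypothesis `hMONO2` (`v = SA (i+1) w`, `t = SL i v`, `d = RL i t`).  NUMERICS OF RECORD (`g72/numerics/m9.py`–`m12.py`;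
flows: lone ages `y ≤ 48` saturated or mild, towers, clusters, dense sets; dampings self-consistent ∕ none ∕ lower envelope ∕ random ∕ alternating in the
relaxed class `[1∕(1+F), 1]`): with `U = R v` the criterion's ratio `M·U∕(A n − A (n+1))` is `≤ 0.68` for every age of every multi-age profile tested and
`≤ 0.97` for lone ages `y ≤ 16`, but reaches `1.01` for a lone UNDAMPED saturated age `y = 48` at its pin; with the second-order `U` it is `≤ 0.83`
throughout (limit `≈ 0.85` as `y → ∞`).  NOT CLAIMED: the criterion for the flow (that is the successor's flow-side inequality: young-kernel decay rate
`≈ 1.5β` per pin against damping defects `≤ 0.5β` and old-surplus growth, `β` = relative level increment); MONOa; anything nonlinear; anything printed.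

WHAT IS PROVED ([folklore]; 0 `def`, 0 sorry).  §1 `antitone_tail_le`, **`read_step_le`**, **`sol_antitone_of_read_decay`**.  §2 `sol_le_input`,
`input_sub_read_le_sol`, `sol_le_input_sub_read` (Neumann sandwich).  §3 `drops_rec`, `drops_tail`, `drops_mem`, **`drops_antitone_of_read_decay`**.
§4 **`young_drops_antitone_of_read_decay`** ((E71b)'s letters, the shape of (E80f)'s `hMONO2` for one age and one input).
-/
noncomputable section
open Finset

namespace Summit.QuantumFields.BalabanUV.Beta.EriceRemainderEnclosureHistoryAutonomyComparisonAgeCompositionReadDecay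

open Summit.QuantumFields.BalabanUV.Beta.EriceRemainderEnclosureHistoryAutonomyComparisonAgeComposition

variable {N : ℕ} {K : ℕ → ℕ → ℝ} {R : (ℕ → ℝ) → ℕ → ℝ}

/-! ## §1 The read-decay criterion -/

/-- A sequence that is non-increasing beyond the depth `n` is below its value at `n+1` at every deeper depth. [folklore] -/
theorem antitone_tail_le {u : ℕ → ℝ} {n : ℕ} (hanti : ∀ m, n < m → u (m + 1) ≤ u m) : ∀ k, u (n + 1 + k) ≤ u (n + 1) := by
  intro k
  induction k with
  | zero => simp
  | succ k ih => exact (by rw [← add_assoc]; exact hanti _ (by omega) : u (n + 1 + (k + 1)) ≤ u (n + 1 + k)).trans ih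

/-- **THE ALIGNED READ STEP.**  Non-negative kernel; `u ≥ 0` non-increasing beyond the depth `n`.  Then the read at `n` exceeds the read at `n+1` by at most
`M n · u (n+1)`, `M n = K n 0 + Σ_{l<N−1} (K n (l+1) − K (n+1) l)⁺` the SHIFT-DOMINATION DEFECT of the row (align the two rows on the common targets
`n+2+l`; the leaving target `n+1` carries `K n 0`, the entering target `n+1+N` is dropped, dominated lags contribute nothing). [folklore] -/
theorem read_step_le (hR : ∀ v n, R v n = ∑ l ∈ range N, K n l * v (n + 1 + l)) (hK : ∀ n l, 0 ≤ K n l)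
    {M : ℕ → ℝ} (hM : ∀ n, M n = K n 0 + ∑ l ∈ range (N - 1), max (K n (l + 1) - K (n + 1) l) 0)
    {u : ℕ → ℝ} (hu0 : ∀ m, 0 ≤ u m) {n : ℕ} (hanti : ∀ m, n < m → u (m + 1) ≤ u m) :
    R u n - R u (n + 1) ≤ M n * u (n + 1) := by
  have hle := antitone_tail_le hanti
  rcases Nat.eq_zero_or_pos N with hN | hN
  · subst hN
    rw [hR, hR, hM]
    simp only [range_zero, sum_empty, sub_self, Nat.zero_sub, add_zero]
    exact mul_nonneg (hK n 0) (hu0 _)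
  obtain ⟨N', rfl⟩ : ∃ N', N = N' + 1 := ⟨N - 1, by omega⟩
  have h1 : R u n = K n 0 * u (n + 1) + ∑ l ∈ range N', K n (l + 1) * u (n + 2 + l) := by
    rw [hR, sum_range_succ']
    rw [add_comm]
    congr 1
    exact sum_congr rfl fun l _ => by rw [show n + 1 + (l + 1) = n + 2 + l by omega]
  have h2 : ∑ l ∈ range N', K (n + 1) l * u (n + 2 + l) ≤ R u (n + 1) := by
    rw [hR, sum_range_succ]
    have : 0 ≤ K (n + 1) N' * u (n + 1 + 1 + N') := mul_nonneg (hK _ _) (hu0 _)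
    have e : ∑ l ∈ range N', K (n + 1) l * u (n + 2 + l) = ∑ l ∈ range N', K (n + 1) l * u (n + 1 + 1 + l) :=
      sum_congr rfl fun l _ => by rw [show n + 2 + l = n + 1 + 1 + l by omega]
    linarith
  have h3 : ∑ l ∈ range N', K n (l + 1) * u (n + 2 + l) - ∑ l ∈ range N', K (n + 1) l * u (n + 2 + l)
      ≤ (∑ l ∈ range N', max (K n (l + 1) - K (n + 1) l) 0) * u (n + 1) := by
    rw [← sum_sub_distrib, sum_mul]
    refine sum_le_sum fun l _ => ?_
    have hul : u (n + 2 + l) ≤ u (n + 1) := by rw [show n + 2 + l = n + 1 + (1 + l) by omega]; exact hle _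
    calc K n (l + 1) * u (n + 2 + l) - K (n + 1) l * u (n + 2 + l) = (K n (l + 1) - K (n + 1) l) * u (n + 2 + l) := by ring
      _ ≤ max (K n (l + 1) - K (n + 1) l) 0 * u (n + 2 + l) := mul_le_mul_of_nonneg_right (le_max_left _ _) (hu0 _)
      _ ≤ max (K n (l + 1) - K (n + 1) l) 0 * u (n + 1) := mul_le_mul_of_nonneg_left hul (le_max_right _ _)
  rw [hM, show N' + 1 - 1 = N' by omega, h1]
  nlinarith [h2, h3]

/-- **THE READ-DECAY CRITERION.**  Non-negative kernel on the horizon `N`; `u` the zero-tailed solution of `u n = A n − R u n` with `u ≥ 0` and `u ≤ U`;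
if at every pin **`M n · U (n+1) ≤ A n − A (n+1)`** (`M` the shift-domination defect of `read_step_le`), then `u` is NON-INCREASING at every depth.
Downward induction from the horizon: `u n − u (n+1) = (A n − A (n+1)) − (R u n − R u (n+1)) ≥ (A n − A (n+1)) − M n · u (n+1) ≥ 0`. [folklore] -/
theorem sol_antitone_of_read_decay (hR : ∀ v n, R v n = ∑ l ∈ range N, K n l * v (n + 1 + l)) (hK : ∀ n l, 0 ≤ K n l)
    {M : ℕ → ℝ} (hM : ∀ n, M n = K n 0 + ∑ l ∈ range (N - 1), max (K n (l + 1) - K (n + 1) l) 0)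
    {A u U : ℕ → ℝ} (hu0 : ∀ m, 0 ≤ u m) (hut : ∀ m, N < m → u m = 0) (hrec : ∀ n, u n = A n - R u n)
    (hU : ∀ m, u m ≤ U m) (hcrit : ∀ n, M n * U (n + 1) ≤ A n - A (n + 1)) : ∀ n, u (n + 1) ≤ u n := by
  have hM0 : ∀ n, 0 ≤ M n := fun n => by
    rw [hM]; exact add_nonneg (hK n 0) (sum_nonneg fun l _ => le_max_right _ _)
  suffices h : ∀ d n, N ≤ n + d → u (n + 1) ≤ u n from fun n => h N n (by omega)
  intro d
  induction d with
  | zero => intro n hn; rw [hut (n + 1) (by omega)]; exact hu0 n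
  | succ d ih =>
    intro n hn
    by_cases hNn : N ≤ n
    · rw [hut (n + 1) (by omega)]; exact hu0 n
    have hanti : ∀ m, n < m → u (m + 1) ≤ u m := fun m hm => ih m (by omega)
    have hstep := read_step_le hR hK hM hu0 hanti
    have hMU : M n * u (n + 1) ≤ M n * U (n + 1) := mul_le_mul_of_nonneg_left (hU _) (hM0 n)
    have e1 := hrec n
    have e2 := hrec (n + 1)
    linarith [hcrit n]

/-! ## §2 The Neumann sandwich (upper and lower bounds of a solution from bounds of the opposite kind) -/

/-- A non-negative solution is below its input: `u n ≤ A n`. [folklore] -/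
theorem sol_le_input (hR : ∀ v n, R v n = ∑ l ∈ range N, K n l * v (n + 1 + l)) (hK : ∀ n l, 0 ≤ K n l)
    {A u : ℕ → ℝ} (hu0 : ∀ m, 0 ≤ u m) (hrec : ∀ n, u n = A n - R u n) (n : ℕ) : u n ≤ A n := by
  have := read_nonneg hR hK (t := u) (n := n) fun m _ => hu0 m
  linarith [hrec n]

/-- An UPPER bound `U ≥ u` gives the LOWER bound `A n − R U n ≤ u n`. [folklore] -/
theorem input_sub_read_le_sol (hR : ∀ v n, R v n = ∑ l ∈ range N, K n l * v (n + 1 + l)) (hK : ∀ n l, 0 ≤ K n l)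
    {A u U : ℕ → ℝ} (hrec : ∀ n, u n = A n - R u n) (hU : ∀ m, u m ≤ U m) (n : ℕ) : A n - R U n ≤ u n := by
  have := read_le_read hR hK (t := u) (v := U) (n := n) fun m _ => hU m
  linarith [hrec n]

/-- A LOWER bound `Λ ≤ u` gives the UPPER bound `u n ≤ A n − R Λ n`. [folklore] -/
theorem sol_le_input_sub_read (hR : ∀ v n, R v n = ∑ l ∈ range N, K n l * v (n + 1 + l)) (hK : ∀ n l, 0 ≤ K n l)
    {A u Λ : ℕ → ℝ} (hrec : ∀ n, u n = A n - R u n) (hΛ : ∀ m, Λ m ≤ u m) (n : ℕ) : u n ≤ A n - R Λ n := by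
  have := read_le_read hR hK (t := Λ) (v := u) (n := n) fun m _ => hΛ m
  linarith [hrec n]

/-! ## §3 Drops of a solution: the same system, with the read of the input as input -/

/-- **DROPS SOLVE THE SAME SYSTEM.**  If `t n = v n − R t n` at every depth then the drops `d = R t` satisfy `d n = R v n − R d n`. [folklore] -/
theorem drops_rec (hR : ∀ v n, R v n = ∑ l ∈ range N, K n l * v (n + 1 + l))
    {v t : ℕ → ℝ} (hrec : ∀ n, t n = v n - R t n) : ∀ n, R t n = R v n - R (R t) n := by
  intro n
  have ht : t = fun m => v m - R t m := funext hrec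
  conv_lhs => rw [ht]
  exact read_sub hR v (R t) n

/-- Drops of a zero-tailed sequence have zero tail. [folklore] -/
theorem drops_tail (hR : ∀ v n, R v n = ∑ l ∈ range N, K n l * v (n + 1 + l))
    {t : ℕ → ℝ} (htail : ∀ n, N < n → t n = 0) : ∀ n, N < n → R t n = 0 :=
  fun n hn => read_eq_zero_of_tail hR (c := 0) (fun m hm => htail m (by omega)) n (by omega)

/-- Drops of a solution lying in `[0, v]` lie in `[0, R v]`. [folklore] -/
theorem drops_mem (hR : ∀ v n, R v n = ∑ l ∈ range N, K n l * v (n + 1 + l)) (hK : ∀ n l, 0 ≤ K n l)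
    {v t : ℕ → ℝ} (htv : ∀ n, 0 ≤ t n ∧ t n ≤ v n) (n : ℕ) : 0 ≤ R t n ∧ R t n ≤ R v n :=
  ⟨read_nonneg hR hK fun m _ => (htv m).1, read_le_read hR hK fun m _ => (htv m).2⟩

/-- **MONO″ FROM THE READ-DECAY CRITERION (one kernel).**  Non-negative kernel on the horizon `N`; `t` the zero-tailed solution of `t = v − R t` lying in
`[0, v]` (e.g. `v` a non-negative supersolution — KEY —, (E71a) `sol_nonneg_le_of_supersol`); `U` any upper bound of the drops `d = R t` (e.g. `U = R v`, or
the second-order `R v − R (R v − R (R v))` by §2); if the reads `A = R v` of the input decay per pin by at least `M n · U (n+1)`, then THE DROPS ARE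
NON-INCREASING IN THE PIN: `R t (n+1) ≤ R t n`. [folklore] -/
theorem drops_antitone_of_read_decay (hR : ∀ v n, R v n = ∑ l ∈ range N, K n l * v (n + 1 + l)) (hK : ∀ n l, 0 ≤ K n l)
    {M : ℕ → ℝ} (hM : ∀ n, M n = K n 0 + ∑ l ∈ range (N - 1), max (K n (l + 1) - K (n + 1) l) 0)
    {v t U : ℕ → ℝ} (htail : ∀ n, N < n → t n = 0) (hrec : ∀ n, t n = v n - R t n) (htv : ∀ n, 0 ≤ t n ∧ t n ≤ v n)
    (hU : ∀ m, R t m ≤ U m) (hcrit : ∀ n, M n * U (n + 1) ≤ R v n - R v (n + 1)) : ∀ n, R t (n + 1) ≤ R t n :=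
  sol_antitone_of_read_decay hR hK hM (fun m => (drops_mem hR hK htv m).1) (drops_tail hR htail) (drops_rec hR hrec) hU hcrit

/-- The first-order instance: `U = R v`. [folklore] -/
theorem drops_antitone_of_read_decay_first (hR : ∀ v n, R v n = ∑ l ∈ range N, K n l * v (n + 1 + l)) (hK : ∀ n l, 0 ≤ K n l)
    {M : ℕ → ℝ} (hM : ∀ n, M n = K n 0 + ∑ l ∈ range (N - 1), max (K n (l + 1) - K (n + 1) l) 0)
    {v t : ℕ → ℝ} (htail : ∀ n, N < n → t n = 0) (hrec : ∀ n, t n = v n - R t n) (htv : ∀ n, 0 ≤ t n ∧ t n ≤ v n)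
    (hcrit : ∀ n, M n * R v (n + 1) ≤ R v n - R v (n + 1)) : ∀ n, R t (n + 1) ≤ R t n :=
  drops_antitone_of_read_decay hR hK hM htail hrec htv (fun m => (drops_mem hR hK htv m).2) hcrit

/-- The second-order instance: `U = R v − R (R v − R (R v))` (the drops are `≥ R v − R (R v)` by `input_sub_read_le_sol` with the first-order bound, hence
`≤ R v − R (R v − R (R v))` by `sol_le_input_sub_read`). [folklore] -/
theorem drops_antitone_of_read_decay_second (hR : ∀ v n, R v n = ∑ l ∈ range N, K n l * v (n + 1 + l)) (hK : ∀ n l, 0 ≤ K n l)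
    {M : ℕ → ℝ} (hM : ∀ n, M n = K n 0 + ∑ l ∈ range (N - 1), max (K n (l + 1) - K (n + 1) l) 0)
    {v t : ℕ → ℝ} (htail : ∀ n, N < n → t n = 0) (hrec : ∀ n, t n = v n - R t n) (htv : ∀ n, 0 ≤ t n ∧ t n ≤ v n)
    (hcrit : ∀ n, M n * (R v (n + 1) - R (fun m => R v m - R (R v) m) (n + 1)) ≤ R v n - R v (n + 1)) :
    ∀ n, R t (n + 1) ≤ R t n := by
  have hdrec := drops_rec hR hrec
  have hU1 : ∀ m, R t m ≤ R v m := fun m => (drops_mem hR hK htv m).2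
  have hΛ : ∀ m, R v m - R (R v) m ≤ R t m := fun m => input_sub_read_le_sol hR hK hdrec hU1 m
  have hU2 : ∀ m, R t m ≤ R v m - R (fun m => R v m - R (R v) m) m := fun m => sol_le_input_sub_read hR hK hdrec hΛ m
  exact drops_antitone_of_read_decay hR hK hM htail hrec htv hU2 hcrit

/-! ## §4 In the letters of (E71b) ∕ (E80f): MONO″ for one age and one input from KEY and the read-decay inequality -/

section Ages

variable {KL : ℕ → ℕ → ℕ → ℝ} {RL SL : ℕ → (ℕ → ℝ) → ℕ → ℝ}

/-- **MONO″ FOR ONE AGE FROM THE READ-DECAY CRITERION** — the shape of (E80f) `flow_nonneg_of_mono2`'s hypothesis `hMONO2` for one age `i` and one old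
surplus `v` (`= SA (i+1) w`): lone kernels `KL i ≥ 0` with reads `RL i` and zero-tailed solution operators `SL i` on the horizon `N`; `v ≥ 0` zero-tailed and a
SUPERSOLUTION of the young kernel (KEY_i: `RL i v ≤ v`, supplied by the static chain through (E80d)); `U` an upper bound of the young drops `RL i (SL i v)`
(`U = RL i v` always qualifies: `hU` of `drops_antitone_of_read_decay_first`); and the READ-DECAY INEQUALITY for the young reads of the old surplus:
`M n · U (n+1) ≤ RL i v n − RL i v (n+1)` with the shift-domination defect `M` of the young kernel.  Then `m ↦ RL i (SL i v) m` is NON-INCREASING.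
[folklore] -/
theorem young_drops_antitone_of_read_decay
    (hRL : ∀ i v m, RL i v m = ∑ l ∈ range N, KL i m l * v (m + 1 + l)) (hKL : ∀ i m l, 0 ≤ KL i m l)
    (hSL : ∀ i (w : ℕ → ℝ), (∀ m, N < m → w m = 0) → (∀ m, N < m → SL i w m = 0) ∧ ∀ m, SL i w m = w m - RL i (SL i w) m)
    {i : ℕ} {M : ℕ → ℝ} (hM : ∀ n, M n = KL i n 0 + ∑ l ∈ range (N - 1), max (KL i n (l + 1) - KL i (n + 1) l) 0)
    {v U : ℕ → ℝ} (hv0 : ∀ m, 0 ≤ v m) (hvt : ∀ m, N < m → v m = 0) (hkey : ∀ m, RL i v m ≤ v m)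
    (hU : ∀ m, RL i (SL i v) m ≤ U m) (hcrit : ∀ n, M n * U (n + 1) ≤ RL i v n - RL i v (n + 1)) :
    ∀ m, RL i (SL i v) (m + 1) ≤ RL i (SL i v) m := by
  have htv := sol_nonneg_le_of_supersol (hRL i) (hKL i) hv0 hkey (hSL i v hvt).1 (hSL i v hvt).2
  exact drops_antitone_of_read_decay (hRL i) (hKL i) hM (hSL i v hvt).1 (hSL i v hvt).2 htv hU hcrit

end Ages

end Summit.QuantumFields.BalabanUV.Beta.EriceRemainderEnclosureHistoryAutonomyComparisonAgeCompositionReadDecay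

end
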